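import Summits.AtomisticToContinuum.Crystallization.Theorems.FreeSplittingCertificatesRadiusLadderPacking
import Summits.AtomisticToContinuum.Crystallization.Theorems.FreeSplittingCertificatesRadiusLadderRefValue
import Summits.AtomisticToContinuum.Crystallization.Theorems.FreeSplittingCertificatesRadiusLadderStars
import Literature.Barriers.AtomisticToContinuum.StickySphereClustersNarrow

/-!
# `FiniteRangeSplitting` (stmt-AtomisticToContinuum-12559): the hard-core end of the `δ`-ladder, decided

Support file for crux r2 of route `FreeSplittingCertificates` (block-2b unit `b2b-freesplit-A`, gen 11).
VALUE = a theorem deciding instances of the crux — NOT summit progress.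

The crux is `∀ δ > 0, ∃ R > 0, RungAt δ R` (`finiteRangeSplitting_iff_rung`).  Its instances at LARGE hard
cores are decided here by the simplest rule of all, the HALF RULE `halfRule = Φ ≡ ½` (every bond split evenly,
pattern-blind, radius-blind; `…RadiusLadderPeriodicHalf`):

* `rungAt_four_thirds`, `rungAt_of_four_thirds_le`, `exists_rung_of_four_thirds_le` — for every hard core
  `δ ≥ 4/3` and EVERY radius `R`, `RungAt δ R` holds: the half rule is feasible.  Proof: at a site of a
  `4/3`-separated configuration the half pair-sum `½ Σ_j V(r_ij)` is `≥ −0.64513 > −0.7175 ≥ e_∞`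
  (`halfSum_ge_of_sep`, `eInf_le_ref`), by a LAYER-CAKE MAJORISATION: `V` is increasing on `[1, ∞)`
  (`strictMonoOn_lennardJones`), so on the grid `t_k = 4/3 + k/10` (`k ≤ 40`) each bond contributes at least
  the tabulated `v_k ≤ V(t_k)` of its shell; the number of neighbours within `t` is at most `(2t/δ + 1)³ − 1`
  (volume packing, `card_le_of_separated_of_dist_le`); Abel summation puts the extremal counts on that envelope;
  and beyond `16/3 = 4δ` the attractive tail is `≤ (1331/512)·δ⁻⁶/6` (`sum_inv_pow_six_far_le`, the tree's shell
  sum `sum_inv_pow_six_le` restricted to shells `b ≥ 4`).  The resulting rational inequality (40 tabulated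
  values) is `decide +kernel` over `ℚ` (`gridQ_ge`) and cast to `ℝ`.
* `not_feasible_halfRule_of_le` — conversely the half rule is INFEASIBLE at every radius for every hard core
  `δ ≤ 23/25`: the centre of the lane's star `Star959` has half pair-sum `< B ≤ e_∞` (`Star959.centre_half_sum`,
  `twoConeB_le_eInf`).

So the half rule's own threshold `δ_½` (feasibility of `Φ ≡ ½` does not depend on `R`) satisfies
`23/25 < δ_½ ≤ 4/3` UNCONDITIONALLY (`halfRule_threshold_bracket`), and the crux's `δ`-instances are THEOREMS for
`δ ≥ 4/3`.  Its content is the window `δ ∈ (0, 4/3)`, where over-binding of a site is geometrically possible and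
a feasible rule must move weight between the endpoints of a bond — the regime of the recurrent-pattern LP of
`…RadiusLadder*`.  The constant `4/3` is what the volume packing bound affords (it allows 26 touching neighbours
where the kissing number is 12); the true `δ_½` is presumably close to `1`.
-/

noncomputable section
namespace Summit.AtomisticToContinuum.Crystallization.Theorems.StrictSplittingRuleBirth

open scoped BigOperators Classical
open Literature.MathematicalPhysics.StatisticalMechanics

/-! ## The grid, the table, and the one rational inequality (over `ℚ`, by `decide +kernel`) -/

/-- Tabulated shell values `v_k = ⌊10⁶·V(t_k)⌋/10⁶` (`k < 40`), `v_k = 0` beyond; `t_k = 4/3 + k/10`. -/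
def vq : ℕ → ℚ
  | 0 => -(27024 / 1000000)
  | 1 => -(18113 / 1000000)
  | 2 => -(12331 / 1000000)
  | 3 => -(8547 / 1000000)
  | 4 => -(6033 / 1000000)
  | 5 => -(4332 / 1000000)
  | 6 => -(3162 / 1000000)
  | 7 => -(2342 / 1000000)
  | 8 => -(1759 / 1000000)
  | 9 => -(1338 / 1000000)
  | 10 => -(1030 / 1000000)
  | 11 => -(801 / 1000000)
  | 12 => -(630 / 1000000)
  | 13 => -(500 / 1000000)
  | 14 => -(400 / 1000000)
  | 15 => -(322 / 1000000)
  | 16 => -(262 / 1000000)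
  | 17 => -(214 / 1000000)
  | 18 => -(177 / 1000000)
  | 19 => -(146 / 1000000)
  | 20 => -(122 / 1000000)
  | 21 => -(102 / 1000000)
  | 22 => -(86 / 1000000)
  | 23 => -(73 / 1000000)
  | 24 => -(62 / 1000000)
  | 25 => -(53 / 1000000)
  | 26 => -(46 / 1000000)
  | 27 => -(39 / 1000000)
  | 28 => -(34 / 1000000)
  | 29 => -(29 / 1000000)
  | 30 => -(26 / 1000000)
  | 31 => -(22 / 1000000)
  | 32 => -(20 / 1000000)
  | 33 => -(17 / 1000000)
  | 34 => -(15 / 1000000)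
  | 35 => -(14 / 1000000)
  | 36 => -(12 / 1000000)
  | 37 => -(11 / 1000000)
  | 38 => -(10 / 1000000)
  | 39 => -(9 / 1000000)
  | _ => 0

/-- Grid points over `ℚ`. -/
def tq (k : ℕ) : ℚ := 4 / 3 + (k : ℚ) / 10

/-- Envelope counts `n_k = (2 t_{k+1}/δ + 1)³ − 1` at `δ = 4/3`, over `ℚ`. -/
def nq (k : ℕ) : ℚ := (2 * tq (k + 1) / (4 / 3) + 1) ^ 3 - 1

/-- The grid constant `Σ_{k<40} (v_k − v_{k+1}) n_k − (1331/512)(4/3)⁻⁶/6` (`≈ −1.29025`). -/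
def gridQ : ℚ :=
  ∑ k ∈ Finset.range 40, (vq k - vq (k + 1)) * nq k - (1 / 6) * (1331 / 512 * (4 / 3 : ℚ)⁻¹ ^ 6)

/-- **The one inequality**: the grid constant is `≥ −1.435 = 2·(−0.7175)`. -/
theorem gridQ_ge : -(1435 / 1000 : ℚ) ≤ gridQ := by
  decide +kernel

/-- The table is nondecreasing (up to `v_40 = 0`). -/
theorem vq_le_succ : ∀ k, k < 40 → vq k ≤ vq (k + 1) := by
  decide +kernel

/-! ## The same objects over `ℝ` -/

/-- Grid points `t_k = 4/3 + k/10`. -/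
def tk (k : ℕ) : ℝ := 4 / 3 + (k : ℝ) / 10

/-- Tabulated shell values, cast. -/
def vk (k : ℕ) : ℝ := vq k

/-- Layer weights `w_k = v_k − v_{k+1}`. -/
def wk (k : ℕ) : ℝ := vk k - vk (k + 1)

/-- Envelope counts over `ℝ`. -/
def nk (k : ℕ) : ℝ := (2 * tk (k + 1) / (4 / 3) + 1) ^ 3 - 1

/-- The rational and real grids agree. -/
theorem tk_cast (k : ℕ) : ((tq k : ℚ) : ℝ) = tk k := by
  simp only [tq, tk]
  push_cast
  ring

/-- The rational and real envelope counts agree. -/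
theorem nk_cast (k : ℕ) : ((nq k : ℚ) : ℝ) = nk k := by
  simp only [nq, nk, ← tk_cast]
  push_cast
  ring

/-- The grid is monotone. -/
theorem tk_mono : Monotone tk := fun a b hab => by
  simp only [tk]
  have : (a : ℝ) ≤ b := by exact_mod_cast hab
  linarith

/-- The grid starts at `4/3`. -/
theorem four_thirds_le_tk (k : ℕ) : 4 / 3 ≤ tk k := by
  simp only [tk]
  have : (0 : ℝ) ≤ (k : ℝ) / 10 := by positivity
  linarith

/-- The last grid point `t_40 = 16/3 = 4·(4/3)`. -/
theorem tk_forty : tk 40 = 4 * (4 / 3) := by norm_num [tk]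

/-- Beyond the table the value is `0`. -/
theorem vk_forty : vk 40 = 0 := by
  have : vq 40 = 0 := rfl
  simp [vk, this]

/-- The table under-estimates `V` on the grid (40 `norm_num` evaluations). -/
theorem vk_le_lennardJones : ∀ k, k < 40 → vk k ≤ lennardJones (tk k) := by
  intro k hk
  interval_cases k <;> norm_num [vk, vq, tk, lennardJones]

/-- The layer weights are nonpositive (the table is nondecreasing). -/
theorem wk_nonpos {k : ℕ} (hk : k < 40) : wk k ≤ 0 := by
  have h := (Rat.cast_le (K := ℝ)).2 (vq_le_succ k hk)
  simp only [wk, vk]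
  linarith

/-- The grid constant over `ℝ`: `Σ_k w_k n_k − (1331/512)(4/3)⁻⁶/6 ≥ −1.435`. -/
theorem grid_sum_ge :
    -(1435 / 1000 : ℝ) ≤
      ∑ k ∈ Finset.range 40, wk k * nk k - (1 / 6) * (1331 / 512 * (4 / 3 : ℝ)⁻¹ ^ 6) := by
  have h := (Rat.cast_le (K := ℝ)).2 gridQ_ge
  have e : ((gridQ : ℚ) : ℝ) =
      ∑ k ∈ Finset.range 40, wk k * nk k - (1 / 6) * (1331 / 512 * (4 / 3 : ℝ)⁻¹ ^ 6) := by
    simp only [gridQ, wk, vk, ← nk_cast]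
    push_cast
    rfl
  have e' : ((-(1435 / 1000 : ℚ) : ℚ) : ℝ) = -(1435 / 1000 : ℝ) := by push_cast; rfl
  linarith [h, e, e']

/-! ## The layer-cake majorant -/

/-- The layer-cake step function `Σ_k w_k·[r < t_{k+1}]`. -/
def layer (r : ℝ) : ℝ := ∑ k ∈ Finset.range 40, wk k * (if r < tk (k + 1) then 1 else 0)

/-- The far tail term `−r⁻⁶/6` beyond `t_40 = 16/3`. -/
def tailTerm (r : ℝ) : ℝ := if tk 40 ≤ r then -((1 / 6) * (r⁻¹) ^ 6) else 0

/-- Telescoping of the layer weights from a shell index. -/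
theorem sum_ite_sub_eq (v : ℕ → ℝ) (k₀ : ℕ) : ∀ M, k₀ ≤ M →
    ∑ k ∈ Finset.range M, (if k₀ ≤ k then v k - v (k + 1) else 0) = v k₀ - v M := by
  refine Nat.le_induction ?_ fun M hM ih => ?_
  · rw [sub_self]
    exact Finset.sum_eq_zero fun k hk => by
      have : ¬ k₀ ≤ k := not_le.2 (Finset.mem_range.1 hk)
      simp [this]
  · rw [Finset.sum_range_succ, ih, if_pos hM]
    ring

/-- **Pointwise majorant**: for `r ≥ 4/3`, `V(r) ≥ layer r + tailTerm r`. -/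
theorem layer_add_tail_le {r : ℝ} (hr : 4 / 3 ≤ r) : layer r + tailTerm r ≤ lennardJones r := by
  by_cases hfar : tk 40 ≤ r
  · -- far: every indicator vanishes, the tail term is the attractive part
    have h0 : layer r = 0 := by
      refine Finset.sum_eq_zero fun k hk => ?_
      have hk : k + 1 ≤ 40 := Finset.mem_range.1 hk
      have : ¬ r < tk (k + 1) := not_lt.2 ((tk_mono hk).trans hfar)
      simp [this]
    rw [h0, zero_add, tailTerm, if_pos hfar]
    have hr0 : 0 < r := by linarith
    exact neg_le_lennardJones_of_le hr0 le_rfl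
  · -- near: `t_{k₀} ≤ r < t_{k₀+1}` with `k₀ < 40`
    rw [not_le] at hfar
    have hr0 : 0 ≤ (r - 4 / 3) * 10 := by linarith
    set k₀ : ℕ := ⌊(r - 4 / 3) * 10⌋₊ with hk₀
    have h1 : tk k₀ ≤ r := by
      have := Nat.floor_le hr0
      simp only [tk]; linarith
    have h2 : r < tk (k₀ + 1) := by
      have := Nat.lt_floor_add_one ((r - 4 / 3) * 10)
      simp only [tk]; push_cast; linarith
    have hk40 : k₀ < 40 := by
      by_contra h
      rw [not_lt] at h
      have : tk 40 ≤ tk k₀ := tk_mono h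
      linarith
    have hind : ∀ k, (r < tk (k + 1) ↔ k₀ ≤ k) := fun k => by
      constructor
      · intro h
        by_contra hlt
        rw [not_le] at hlt
        have : tk (k + 1) ≤ tk k₀ := tk_mono (by omega)
        linarith
      · intro h
        have : tk (k₀ + 1) ≤ tk (k + 1) := tk_mono (by omega)
        linarith
    have hsum : layer r = vk k₀ - vk 40 := by
      rw [← sum_ite_sub_eq vk k₀ 40 hk40.le]
      refine Finset.sum_congr rfl fun k _ => ?_
      by_cases h : k₀ ≤ k
      · rw [if_pos ((hind k).2 h), if_pos h, wk, mul_one]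
      · have : ¬ r < tk (k + 1) := fun h' => h ((hind k).1 h')
        rw [if_neg this, if_neg h, mul_zero]
    rw [hsum, vk_forty, sub_zero, tailTerm, if_neg (not_le.2 hfar), add_zero]
    exact (vk_le_lennardJones k₀ hk40).trans
      (Literature.Barriers.AtomisticToContinuum.strictMonoOn_lennardJones.monotoneOn
        (Set.mem_Ici.2 (le_trans (by norm_num) (four_thirds_le_tk k₀)))
        (Set.mem_Ici.2 (le_trans (by norm_num) hr)) h1)

/-! ## The certified floor of the pair-sum at hard core `4/3` -/

/-- **Certified floor**: at every site of every `4/3`-separated finite configuration the pair-sum is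
`≥ −1.435`. -/
theorem sum_lennardJones_ge_of_sep {N : ℕ} {x : Fin N → EuclideanSpace ℝ (Fin 3)} (hx : Sep (4 / 3) x) (i : Fin N) :
    -(1435 / 1000 : ℝ) ≤ ∑ j ∈ Finset.univ.erase i, lennardJones (dist (x i) (x j)) := by
  set S := Finset.univ.erase i with hS
  have hδ : (0 : ℝ) < 4 / 3 := by norm_num
  have hdist : ∀ j ∈ S, 4 / 3 ≤ dist (x i) (x j) := fun j hj =>
    hx i j (Finset.ne_of_mem_erase hj).symm
  -- pointwise majorant, summed
  have step1 : ∑ j ∈ S, (layer (dist (x i) (x j)) + tailTerm (dist (x i) (x j))) ≤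
      ∑ j ∈ S, lennardJones (dist (x i) (x j)) :=
    Finset.sum_le_sum fun j hj => layer_add_tail_le (hdist j hj)
  -- the layer part: swap sums, bound counts by the envelope (weights are nonpositive)
  have step2 : ∑ k ∈ Finset.range 40, wk k * nk k ≤ ∑ j ∈ S, layer (dist (x i) (x j)) := by
    have hswap : ∑ j ∈ S, layer (dist (x i) (x j)) =
        ∑ k ∈ Finset.range 40, wk k * ∑ j ∈ S, (if dist (x i) (x j) < tk (k + 1) then (1 : ℝ) else 0) := by
      simp only [layer, Finset.mul_sum]
      exact Finset.sum_comm
    rw [hswap]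
    refine Finset.sum_le_sum fun k hk => ?_
    have hcount : ∑ j ∈ S, (if dist (x i) (x j) < tk (k + 1) then (1 : ℝ) else 0) ≤ nk k := by
      rw [Finset.sum_boole, nk]
      exact card_near_le hδ hx i (le_trans (by norm_num) (four_thirds_le_tk (k + 1)))
    exact mul_le_mul_of_nonpos_left hcount (wk_nonpos (Finset.mem_range.1 hk))
  -- the tail part
  have step3 : -((1 / 6) * (1331 / 512 * (4 / 3 : ℝ)⁻¹ ^ 6)) ≤ ∑ j ∈ S, tailTerm (dist (x i) (x j)) := by
    have hsplit : ∑ j ∈ S, tailTerm (dist (x i) (x j)) =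
        ∑ j ∈ S.filter (fun j => tk 40 ≤ dist (x i) (x j)), -((1 / 6) * (dist (x i) (x j))⁻¹ ^ 6) := by
      rw [Finset.sum_filter]
      rfl
    have htail := sum_inv_pow_six_far_le x hδ hx i
    rw [← tk_forty] at htail
    rw [hsplit, Finset.sum_neg_distrib, ← Finset.mul_sum, neg_le_neg_iff]
    exact mul_le_mul_of_nonneg_left htail (by norm_num)
  have := grid_sum_ge
  rw [Finset.sum_add_distrib] at step1
  linarith

/-- **The half pair-sum never drops below `−0.7175` at hard core `4/3`.** -/
theorem halfSum_ge_of_sep {N : ℕ} {x : Fin N → EuclideanSpace ℝ (Fin 3)} (hx : Sep (4 / 3) x) (i : Fin N) :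
    -(7175 / 10000 : ℝ) ≤ (∑ j ∈ Finset.univ.erase i, lennardJones (dist (x i) (x j))) / 2 := by
  have := sum_lennardJones_ge_of_sep hx i
  linarith

/-! ## The rungs -/

/-- **The half rule is feasible at hard core `4/3`, at every radius.** -/
theorem feasible_halfRule_four_thirds (R : ℝ) : Feasible (4 / 3) R halfRule := fun N x hx i => by
  rw [siteE_halfRule]
  exact eInf_le_ref.trans (halfSum_ge_of_sep hx i)

/-- **`RungAt (4/3) R` for every `R`.** -/
theorem rungAt_four_thirds (R : ℝ) : RungAt (4 / 3) R :=
  ⟨halfRule, isRule_halfRule, feasible_halfRule_four_thirds R⟩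

/-- **The hard-core end of the `δ`-ladder**: every `δ ≥ 4/3` has every rung. -/
theorem rungAt_of_four_thirds_le {δ : ℝ} (hδ : 4 / 3 ≤ δ) (R : ℝ) : RungAt δ R :=
  rungAt_mono_sep hδ (rungAt_four_thirds R)

/-- Read back on crux r2: its `δ`-instances for `δ ≥ 4/3` are theorems (witness: any `R > 0`, the half rule). -/
theorem exists_rung_of_four_thirds_le : ∀ δ : ℝ, 4 / 3 ≤ δ → ∃ R : ℝ, 0 < R ∧ RungAt δ R :=
  fun _ hδ => ⟨1, one_pos, rungAt_of_four_thirds_le hδ 1⟩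

/-- … and the restricted crux in the crux's own shape. -/
theorem finiteRangeSplitting_of_hardCore : ∀ δ : ℝ, 4 / 3 ≤ δ →
    ∃ (R : ℝ) (Φ : EuclideanSpace ℝ (Fin 3) → Finset (EuclideanSpace ℝ (Fin 3)) → ℝ), 0 < R ∧ IsRule Φ ∧ Feasible δ R Φ :=
  fun _ hδ => ⟨1, halfRule, one_pos, isRule_halfRule, feasible_mono_sep hδ (feasible_halfRule_four_thirds 1)⟩

/-! ## The other side: the half rule is dead up to `23/25` -/

/-- **The half rule is infeasible at hard core `23/25`, at every radius** (centre of `Star959`). -/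
theorem not_feasible_halfRule_23_25 (R : ℝ) : ¬ Feasible (23 / 25) R halfRule := by
  intro hf
  have h := hf _ Star959.conf Star959.sep_conf Star959.i0
  rw [siteE_halfRule] at h
  have hlt := Star959.centre_half_sum
  have hB := twoConeB_le_eInf
  linarith

/-- Hence at every hard core `δ ≤ 23/25` and every radius. -/
theorem not_feasible_halfRule_of_le {δ : ℝ} (hδ : δ ≤ 23 / 25) (R : ℝ) : ¬ Feasible δ R halfRule :=
  fun hf => not_feasible_halfRule_23_25 R (feasible_mono_sep hδ hf)

/-- **Bracket for the half rule's threshold**: feasible at every radius from `4/3` on, infeasible at every radius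
up to `23/25`. -/
theorem halfRule_threshold_bracket (R : ℝ) :
    (∀ δ : ℝ, 4 / 3 ≤ δ → Feasible δ R halfRule) ∧ (∀ δ : ℝ, δ ≤ 23 / 25 → ¬ Feasible δ R halfRule) :=
  ⟨fun _ hδ => feasible_mono_sep hδ (feasible_halfRule_four_thirds R),
    fun _ hδ => not_feasible_halfRule_of_le hδ R⟩

end Summit.AtomisticToContinuum.Crystallization.Theorems.StrictSplittingRuleBirth

end
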